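import Summits.BirchSwinnertonDyer.BirchSwinnertonDyer.Theses.TorsionLayerDescent
import Summits.BirchSwinnertonDyer.BirchSwinnertonDyer.Theorems.PrintX9HowardRankOne
import HarnessLib

/-!
# Route `TorsionLayerDescent` — the ASSEMBLY item, kernel-checked (critic price 1)

`Summit.BirchSwinnertonDyer.BirchSwinnertonDyer.Theses.TorsionLayerDescent.Assembly` :=
`HowardContainmentAnyClassNumber → TwoSidedLinkAnyClassNumber → LightFrameSupplyOdd → EngineIMCX9 →
DescentPrintFacts → BSDpOnClassX9` is PROVED here — a verbatim copy of the landed X9 Howard road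
(`Theorems/PrintX9HowardIMCLink.lean` §3 `X9.indexIdentityAt_of_heegner_of_cor46_of_thm331` and
`Theorems/PrintX9HowardRankOne.lean` §1–§2) with the frame binder `¬ p ∣ h_K` DELETED: its two use
sites (Mastella–Zerman Cor. 4.6's containment, the Yan–Zhu/BCS/CGLS two-sided link) are replaced by the
route's cruxes A (`HowardContainmentAnyClassNumber`) and B (`TwoSidedLinkAnyClassNumber`); the frame
supply is the route's LIGHT supply F (`LightFrameSupplyOdd`, no class-number conjunct); the published
inputs are the conjunction D (`DescentPrintFacts`); the K6 rank-`0` engine is E (`EngineIMCX9` :=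
`IntegralMainConjectureOnClassX9` BY NAME, OPEN). Nothing is booked: A, B, E are OPEN items of the
route and enter as hypotheses. No summit and no leaf is proved by this file — it only certifies that
the route's cone is honest (the copy needs `hhK` nowhere else).

THEOREMS ONLY (no definition, no named fact, no `sorry`); cell-independent (ideator seat bsd-idea-2).
-/

set_option linter.dupNamespace false
set_option autoImplicit false

noncomputable section

open scoped Classical MatrixGroups ModularForm

open CongruenceSubgroup WeierstrassCurve NumberField IsDedekindDomain
  Literature.NumberTheory.EllipticCurves Literature.NumberTheory.EllipticCurves.ModularForms
  Literature.NumberTheory.EllipticCurves.BurungaleCastellaSkinner2025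
  Literature.NumberTheory.EllipticCurves.JetchevSkinnerWan2017
  Literature.NumberTheory.EllipticCurves.YanZhu2026
  Summit.BirchSwinnertonDyer.BirchSwinnertonDyer.Theorems.Rank1ResidualX1Defs
  Summit.BirchSwinnertonDyer.Rank1Residual

open Literature.NumberTheory.EllipticCurves.Rank1Residual (GoodOrd Irr Surj BigIm
  norm_periodRatio_eq_one pPart_of_bsdp not_dvd_discr_of_split)

open Summit.BirchSwinnertonDyer.BirchSwinnertonDyer.Theses.TorsionLayerDescent
  (HowardContainmentAnyClassNumber TwoSidedLinkAnyClassNumber LightFrameSupplyOdd EngineIMCX9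
    DescentPrintFacts Assembly)

namespace Summit.BirchSwinnertonDyer.BirchSwinnertonDyer.Rank1Residual

namespace TorsionLayer

/-! ### §1 The Heegner-index identity over `K` at a rank-one X9 datum — NO class-number hypothesis -/

/-- IMCLink §3 with `hhK` deleted: the containment is crux A, the two-sided link is crux B. -/
theorem indexIdentityAt_of_cruxes
    (hA : HowardContainmentAnyClassNumber) (hB : TwoSidedLinkAnyClassNumber)
    (h331 : thm331_anticyclotomicControl)
    (hmod : hasEntireLFunction_rat) (hGZK : rank_eq_analyticRank_of_analyticRank_le_one)
    (W : WeierstrassCurve ℚ) [W.IsElliptic] [W.IsGloballyMinimal] (p : ℕ) [Fact p.Prime]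
    (K : Type) [Field K] [NumberField K] [NeZero (W.conductorNorm ℤ)]
    (Dt : ModularParametrizationData W (W.conductorNorm ℤ))
    (H : HeegnerDatum (W.conductorNorm ℤ) (NumberField.discr K)) (ιC : K →+* ℂ)
    (P : (W.baseChange K).toAffine.Point)
    (hGZ : gross_zagier (W.conductorNorm ℤ) W K) (hKo : kolyvagin (W.conductorNorm ℤ) W K)
    (hX9 : ClassX9 W p) (hr : W.analyticRank = 1)
    (hK : IsImaginaryQuadratic K) (hodd : Odd (NumberField.discr K)) (hlt : NumberField.discr K < -4)
    (hHN : SatisfiesHeegnerHypothesis (W.conductorNorm ℤ) K) (hHp : SatisfiesHeegnerHypothesis p K)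
    (hLt : (W.quadraticTwist (NumberField.discr K : ℚ)).entireLFunction 1 ≠ 0)
    (hP : WeierstrassCurve.Affine.Point.map ιC.toRatAlgHom P = heegnerPointComplex Dt H)
    (hc : ¬ (p : ℤ) ∣ Dt.c) : X11b.IndexIdentityAt W p K P := by
  have hX9' := classX9_census_of_classX9 W p hX9
  have hpP : p.Prime := Fact.out
  have hp5 : 5 ≤ p := hX9'.five_le
  have hp2 : p ≠ 2 := hX9'.ne_two
  have h3 : NumberField.discr K ≠ -3 := by omega
  have h4 : NumberField.discr K ≠ -4 := by omega
  haveI : Finite (W.baseChange K).sha :=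
    X11b.finite_sha_baseChange_of_heegner W (W.conductorNorm ℤ) K Dt H ιC P hGZ hKo hmod hr hK hHN hLt hP
  obtain ⟨hrQ, hShaQ⟩ := hGZK W hr.le
  rw [hr] at hrQ
  obtain ⟨hrk, hfinp⟩ :=
    mordellWeilRank_baseChange_eq_one_and_finite_sha_of_twist_L_one_ne_zero hGZK W K hK p hrQ hShaQ
      hLt
  have hPinf : ¬ IsOfFinAddOrder P :=
    X11b.not_isOfFinAddOrder_of_heegner_of_analyticRank_eq_one W (W.conductorNorm ℤ) K Dt H ιC P hGZ
      hmod hr hK hHN hLt hP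
  -- (irr_K) at this field (Matar–Nekovář Prop. 5.26 (2), a tree theorem)
  have hirrK : (W.baseChange K).HasIrreducibleModPGaloisRep p :=
    MatarNekovar2019.prop526_hasIrreducibleModPGaloisRep_baseChange_holds W K hK.1
      (Literature.SatisfiesHeegnerHypothesis.coprime_discr hK.1 hHN) p hp2 hX9'.irr
  -- the anticyclotomic datum and the embedding at a prime above `p`
  obtain ⟨κ, γ, 𝔭, hκ, hγ, h𝔭⟩ := X11b.exists_anticyclotomic_generator_prime (p := p) hK
  haveI : Fact (κ.IsTopGenerator γ) := ⟨hγ⟩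
  have hsplit : X11b.SplitsIn K p := hHp p Fact.out (dvd_refl p)
  obtain ⟨he, hf⟩ := X11b.degreeOne_of_splitsIn hK.1 hsplit h𝔭
  set ι : K →+* ℚ_[p] := X11b.embAt K p 𝔭 h𝔭 he hf with hι
  -- control (JSW 3.3.1); containment = crux A; two-sided link = crux B
  have hCTL : X11b.ControlOnTreeGoodAt p κ (X11b.inducedPlace ι) γ ι P :=
    X11b.controlOnTreeGoodAt_of_thm331_of_inducedPlace h331 (by omega) hX9'.good hK hHp rfl hHN hirrK ι
      κ hκ γ hrk hfinp P hPinf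
  have hHow := hA W p K hX9 hK h3 h4 hHN hHp κ hκ γ hγ Dt H ιC
  have hIW : X11b.IMCWaldspurgerOnTreeGoodAt p κ (X11b.inducedPlace ι) γ ι P :=
    hB W p K hX9 hK hodd h3 hHN hHp hirrK ι κ hκ γ Dt hc H ιC P hP hrk hfinp hPinf hHow
  exact X11b.indexIdentityAt_of_onTreeGoodLinks_of_allSplit hK rfl hHN hIW hCTL

/-! ### §2 Rank one at an X9 pair on a LIGHT frame (no `p ∤ h_K`) — any Tamagawa depth -/

/-- HowardRankOne §1 with `hhK` deleted (the identity over `K` comes from §1 above). -/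
theorem bsdp_rankOne_of_lightFrame_of_cruxes
    (hA : HowardContainmentAnyClassNumber) (hB : TwoSidedLinkAnyClassNumber)
    (h331 : thm331_anticyclotomicControl)
    (hGZ : ∀ (N : ℕ) [NeZero N] (W : WeierstrassCurve ℚ) (K : Type) [Field K] [NumberField K],
      gross_zagier N W K)
    (hKo : ∀ (N : ℕ) [NeZero N] (W : WeierstrassCurve ℚ) (K : Type) [Field K] [NumberField K],
      kolyvagin N W K)
    (hGr : greenberg_charValue_rankZero) (hGZK : rank_eq_analyticRank_of_analyticRank_le_one)
    (hmod : hasEntireLFunction_rat) (hpar : nonempty_modularParametrizationData)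
    (hnf : exists_isNewformOf)
    (hMaz : mazur_not_dvd_maninConstant_of_odd) (hNS : integral_neronScaling_of_isGloballyMinimal)
    (h5 : realPeriodRat_eq_unit_mul_plusPeriod)
    (W : WeierstrassCurve ℚ) [W.IsElliptic] [W.IsGloballyMinimal] (p : ℕ) [Fact p.Prime]
    (hX9 : ClassX9 W p) (hr : W.analyticRank = 1)
    (K : Type) [Field K] [NumberField K] (hK : IsImaginaryQuadratic K)
    (hodd : Odd (NumberField.discr K)) (hlt : NumberField.discr K < -4)
    (hHN : SatisfiesHeegnerHypothesis (W.conductorNorm ℤ) K) (hHp : SatisfiesHeegnerHypothesis p K)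
    (hLt : (W.quadraticTwist (NumberField.discr K : ℚ)).entireLFunction 1 ≠ 0)
    (hIMC : IntegralMainConjectureOnClassX9) : BSDp W p := by
  obtain ⟨-, hp5, hgood, hord, hirr, -⟩ := id hX9
  have hpP : p.Prime := Fact.out
  have hp2 : p ≠ 2 := by omega
  haveI : NeZero (W.conductorNorm ℤ) := ⟨(W.conductorNorm_pos_holds).ne'⟩
  have hpd : ¬ (p : ℤ) ∣ NumberField.discr K := not_dvd_discr_of_split hK hpP hp2 hHp
  have hμ : ¬ p ∣ Units.torsionOrder K := by
    haveI : IsTotallyComplex K := hK.2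
    rw [Literature.NumberTheory.DiophantineGeometry.torsionOrder_eq_two_of_discr_lt hK.1 hlt]
    intro hdvd
    have := Nat.le_of_dvd two_pos hdvd
    omega
  obtain ⟨Dt, H, ι, P, hP, hc⟩ :=
    X11b.exists_maninDatum_of_good hnf hMaz hNS W p (W.conductorNorm ℤ) K rfl hp2 hgood hirr hK hHN
  have hid : Finite (W.baseChange K).sha → X11b.IndexIdentityAt W p K P := fun _ ↦
    indexIdentityAt_of_cruxes hA hB h331 hmod hGZK W p K Dt H ι P (hGZ _ W K) (hKo _ W K) hX9 hr hK
      hodd hlt hHN hHp hLt hP hc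
  have hD0 : (NumberField.discr K : ℚ) ≠ 0 := by exact_mod_cast NumberField.discr_ne_zero K
  haveI hEt : (W.quadraticTwist (NumberField.discr K : ℚ)).IsElliptic :=
    W.isElliptic_quadraticTwist hD0
  obtain ⟨Cd, hCd⟩ := hasGlobalMinimalModel_rat_holds (W.quadraticTwist (NumberField.discr K : ℚ))
  haveI : (Cd • W.quadraticTwist (NumberField.discr K : ℚ)).IsGloballyMinimal := hCd
  have hWd : Cd • W.quadraticTwist (NumberField.discr K : ℚ) =
      Cd • W.quadraticTwist (NumberField.discr K : ℚ) := rfl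
  have hX9d : ClassX9 (Cd • W.quadraticTwist (NumberField.discr K : ℚ)) p :=
    classX9_twist_model hX9 K hK.1 hpd Cd hWd
  have hordd : GoodOrd (Cd • W.quadraticTwist (NumberField.discr K : ℚ)) p :=
    ⟨hX9d.2.2.1, hX9d.2.2.2.1⟩
  have htam : padicValNat p (Cd • W.quadraticTwist (NumberField.discr K : ℚ)).tamagawaProduct =
      padicValNat p W.tamagawaProduct :=
    X2.padicValNat_tamagawaProduct_twist_of_heegner_of_odd W p hp2 K hK hodd hpd hHN Cd hWd
  have hu : padicValRat p (Cd.u : ℚ) = 0 :=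
    X11b.padicValRat_u_eq_zero_of_twist_good W p hpd hgood Cd hWd hordd.1
  have hMCd : MazurMainConjecture (Cd • W.quadraticTwist (NumberField.discr K : ℚ)) p :=
    mazurMainConjecture_of_integralMainConjectureOnClassX9 h5 hIMC hX9d
  exact X11b.bsdp_rankOne_of_indexIdentityAt_of_twist_mazurMainConjecture W p (W.conductorNorm ℤ) K Dt
    H ι P (hGZ _ W K) (hKo _ W K) hGr hGZK hmod hpar hr hp2 hK hHN hP hc hμ hLt
    (Cd • W.quadraticTwist (NumberField.discr K : ℚ)) Cd hWd hordd htam hu hMCd hid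

/-! ### §3 The route's ASSEMBLY item -/

/-- **`TorsionLayerDescent.Assembly` holds**: cruxes A, B, the light frame supply F, the K6 engine E
and the published facts D give the K6 leaf `BSDpOnClassX9` (HowardRankOne §2 with `hhK` deleted). -/
theorem torsionLayerDescent_assembly : Assembly := by
  intro hA hB hF hE hD
  obtain ⟨h331, hGZ, hKo, hGr, hGZK, hmod, hpar, hnf, hMaz, hNS, h5⟩ := hD
  intro W _ _ p _ hran hX9 _
  obtain ⟨-, hp5, hgood, hord, -, -⟩ := id hX9
  have hbsdp : BSDp W p := by
    rcases Nat.lt_or_ge W.analyticRank 1 with h0 | h1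
    · exact bsdp_of_mazurMainConjecture_of_analyticRank_eq_zero hGr hpar hGZK (by omega) ⟨hgood, hord⟩
        (by omega) (mazurMainConjecture_of_integralMainConjectureOnClassX9 h5 hE hX9)
    · have hr : W.analyticRank = 1 := le_antisymm hran h1
      haveI : NeZero (W.conductorNorm ℤ) := ⟨(W.conductorNorm_pos_holds).ne'⟩
      obtain ⟨K, _, _, hK, hodd, hlt, hHN, hHp, hLt⟩ := hF W p hX9 hr
      exact bsdp_rankOne_of_lightFrame_of_cruxes hA hB h331 hGZ hKo hGr hGZK hmod hpar hnf hMaz hNS h5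
        W p hX9 hr K hK hodd hlt hHN hHp hLt hE
  exact (pPartBSD_iff_pPart W p).mpr (pPart_of_bsdp hmod hGZK W p hran hbsdp)

/-- The same, in the gate's closing shape `theorem … : <RouteSlug>.Assembly` spelled in full. -/
theorem assembly_holds :
    Summit.BirchSwinnertonDyer.BirchSwinnertonDyer.Theses.TorsionLayerDescent.Assembly :=
  torsionLayerDescent_assembly

end TorsionLayer

end Summit.BirchSwinnertonDyer.BirchSwinnertonDyer.Rank1Residual

end
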